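import Mathlib
import Literature.Analysis.FluidPDE.Tao2016AveragedNS.BoundedEternalSolutions
import Summits.NavierStokesRegularity.NavierStokesRegularity.Theorems.TaoLadderRungTwoBreakNoSurvivingEternalViscBddOneWakeDyadicDSSMasterIdentity
import Summits.NavierStokesRegularity.NavierStokesRegularity.Theorems.TaoLadderRungTwoBreakNoSurvivingEternalViscBddOneWakeDyadicDSSFrontOvershoot

/-!
# Crux `TaoLadderRungTwoBreak.NoSurvivingEternalViscBddOne` (stmt-NavierStokesRegularity-20419) / ⟨20205⟩ `NoSurvivingDSSOne`, DYADIC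
# MEMBER, DSS STRATUM: the EXACT LAG-MARGIN CRITERION — a single-profile DSS front whose lag-defect ratio exceeds its overshoot-excess
# ratio by more than `ε₀/(2(1+ε₀))` on ONE lit shell is not (S₁)-surviving (no small-`ε₀` asymptotics)

MODEL lattice ODEs only (non-negative period-one DSS solutions `V_{k+1}(t) = κV_k(κt)`, `0 < κ < Λ`, of the Katz–Pavlović chain in Tao's
critical variables, and the tree's single-profile `IsDSSWave ε₀ dyadicTable π T Φ`); nothing in this file is a statement about the
Navier–Stokes equations, and no stub, crux, rung or summit is proved by it (`--supports stmt-NavierStokesRegularity-20419`).  DEF-FREE.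

The hand 4-g24 landed the MASTER IDENTITY (`…DSSMasterIdentity.master_identity`)

  `E_n = Λ·v_n·(v_n − D_n/(2Λ))/(Λ² − κ√κ) − v_n²/(2Λ(1 − κ²/Λ²))`

between the contraction ratio `κ`, the lag defect `D_n = ∫(√κV_n² − 2V_nV_{n+1} + V_{n+1}²/√κ) ≥ 0` and the lag energy
`E_n = ∫V_{n-1}²(v_n − V_n)`, and READ it to leading order as `θ = (2 − 4d)/(5/2 − 4d)` (`κ = Λ^θ`).  This file turns the reading into an
EXACT theorem valid at every `ε₀ > 0`.  Introduce on a lit shell (`v_n > 0`) the two scale-free ratios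

  lag-defect ratio      `d`  with  `D_n ≥ 2Λ·v_n·d`,
  overshoot-excess ratio `ω` with  `−E_n ≤ ω·Λv_n²/(Λ² − κ√κ)`

(so `ω ≤ 0` when the lag dominates the overshoot, `ω > 0` when shell `n` sits, on the average weighted by the feeding shell's energy,
above its terminal value).  Then:

* `gap_le_of_lag_margin` — the master identity gives the EXACT inequality `Λ² − κ√κ ≤ 2(1 − d + ω)(Λ² − κ²)`;
* `no_survivor_algebra` — pure algebra: with `b = 1+ε₀ > 1`, `s = √κ`, `b ≤ s` (survival, `κ ≥ (1+ε₀)²`), `s⁴ < b⁵` (sub-unitarity,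
  `κ < Λ`) and `(2q − 1)·b < 1` the inequality `b⁵ − s³ ≤ 2q(b⁵ − s⁴)` is IMPOSSIBLE;
* **`kappa_lt_of_lag_margin`** — hence a DSS front with `(1+ε₀)(1 − 2(d − ω)) < 1`, i.e. LAG MARGIN `d − ω > ε₀/(2(1+ε₀))`, on some lit
  shell has `κ < (1+ε₀)²`: it is NOT (S₁)-surviving;
* `sq_le_exp_of_surviving` — the (S₁) window in `κ = e^{T}`: `Surviving 1 ε₀ T → (1+ε₀)² ≤ e^{T}`;
* **`dssWave_not_surviving_of_lag_margin`** — BY NAME for the tree's admissible single-profile DSS waves of `dyadicTable` with a terminal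
  profile: a lag margin `d − ω > ε₀/(2(1+ε₀))` on one lit shell excludes `Surviving 1 ε₀ T`.
* §4: **`lagMargin_eq`** (EXACT `d⋆ − ω⋆ = 1 − (Λ²−κ√κ)/(2(Λ²−κ²))`, a function of `κ` alone) and **`margin_criterion_iff`**
  (`(1+ε₀)(1 − 2m(κ)) < 1 ↔ κ < (1+ε₀)²`): the lag margin IS the survival discriminant; (LD)/(OE) are ONE unknown, not two.

READING for ⟨20205⟩|dyadic (the target for (LD)/(OE) of the 4-g24 census, now one inequality): the Kolmogorov front of the continuum limit
has `d → 1/4`, `ω → 0⁻` (pure lag, no overshoot), i.e. margin `→ 1/4` against the needed `ε₀/(2(1+ε₀)) → 0`; what remains to prove is a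
UNIFORM lower bound `d_n − ω_n ≥ η > ε₀/(2(1+ε₀))` on some lit shell of every admissible single-profile DSS wave of the dyadic member at
small `ε₀` — a statement about ONE scalar profile.  HONEST LABEL: elementary consequence of the identity files; (LD)/(OE), W1-dyadic, (ρ0),
⟨20419⟩, ⟨20205⟩ and every NS statement remain OPEN; rung 0.
-/

-- the summit and its single sub-problem share the name (CONVENTIONS §1)
set_option linter.dupNamespace false

namespace Summit.NavierStokesRegularity.NavierStokesRegularity.Theorems.NoSurvivingEternalViscBddOne.DSSLagMargin

open Filter Topology Set MeasureTheory
open Literature.Analysis.FluidPDE.TaoCascade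
open Summit.NavierStokesRegularity.NavierStokesRegularity.Theorems.NoSurvivingEternalViscBddOne
open Summit.NavierStokesRegularity.NavierStokesRegularity.Theorems.NoSurvivingEternalViscBddOne.WakeCriterion
  (dyadic_crit_hasDerivAt dyadic_crit_tendsto dyadic_classical_hyp_nonneg)

variable {ε₀ κ : ℝ} {V : ℤ → ℝ → ℝ} {v : ℤ → ℝ} {P : ℤ → ℝ → ℝ}

/-! ## §1 Pure algebra: the survival window is incompatible with a lag margin -/

/-- **No-survivor algebra.**  For `b > 1`, `b ≤ s`, `s⁴ < b⁵` and `(2q − 1)b < 1` one has the STRICT inequality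
`2q(b⁵ − s⁴) < b⁵ − s³` (with `b = 1+ε₀`, `s = √κ`, `Λ² = b⁵`: the master inequality `Λ² − κ√κ ≤ 2q(Λ² − κ²)` fails throughout the
(S₁) window `b² ≤ κ < Λ`).  Proof: `s³ ≤ s⁴/b`, then the sign of `2qb − 1` decides which end of `b⁴ ≤ s⁴ < b⁵` to use. [elementary] -/
theorem no_survivor_algebra {b s q : ℝ} (hb : 1 < b) (hbs : b ≤ s) (hs4 : s ^ 4 < b ^ 5) (hq : (2 * q - 1) * b < 1) :
    2 * q * (b ^ 5 - s ^ 4) < b ^ 5 - s ^ 3 := by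
  have hb0 : 0 < b := by linarith
  have hs0 : 0 < s := by linarith
  have hs3 : s ^ 3 ≤ s ^ 4 / b := by
    rw [le_div_iff₀ hb0]
    nlinarith [pow_pos hs0 3]
  -- it suffices to bound `2q s⁴ − s³` from below by `s⁴ (2qb − 1)/b`
  have hkey : s ^ 4 * (2 * q * b - 1) / b ≤ 2 * q * s ^ 4 - s ^ 3 := by
    have e : s ^ 4 * (2 * q * b - 1) / b = 2 * q * s ^ 4 - s ^ 4 / b := by
      field_simp
    rw [e]; linarith
  have hb4 : b ^ 4 ≤ s ^ 4 := pow_le_pow_left₀ hb0.le hbs 4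
  rcases le_or_gt 0 (2 * q * b - 1) with hpos | hneg
  · -- `2qb ≥ 1`: use `s⁴ ≥ b⁴`
    have h1 : b ^ 4 * (2 * q * b - 1) / b ≤ s ^ 4 * (2 * q * b - 1) / b :=
      div_le_div_of_nonneg_right (mul_le_mul_of_nonneg_right hb4 hpos) hb0.le
    have h2 : b ^ 4 * (2 * q * b - 1) / b = b ^ 3 * (2 * q * b - 1) := by
      field_simp
    -- `b³(2qb − 1) > (2q − 1)b⁵` iff `2qb − 1 > (2q−1)b²` iff `(b − 1)(1 − (2q−1)b) > 0`
    have h3 : (2 * q - 1) * b ^ 2 < 2 * q * b - 1 := by nlinarith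
    have h4 : (2 * q - 1) * b ^ 5 < b ^ 3 * (2 * q * b - 1) := by
      have := mul_lt_mul_of_pos_left h3 (pow_pos hb0 3)
      nlinarith
    nlinarith
  · -- `2qb < 1`: use `s⁴ < b⁵` (the coefficient is negative)
    have h1 : b ^ 5 * (2 * q * b - 1) / b < s ^ 4 * (2 * q * b - 1) / b :=
      div_lt_div_of_pos_right (mul_lt_mul_of_neg_right hs4 hneg) hb0
    have h2 : b ^ 5 * (2 * q * b - 1) / b = b ^ 4 * (2 * q * b - 1) := by
      field_simp
    -- `b⁴(2qb − 1) ≥ (2q − 1)b⁵` iff `2qb − 1 ≥ (2q − 1)b` iff `b ≥ 1`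
    have h4 : (2 * q - 1) * b ^ 5 ≤ b ^ 4 * (2 * q * b - 1) := by
      nlinarith [pow_pos hb0 4]
    nlinarith

/-! ## §2 The master inequality under a lag margin -/

/-- **`Λ² − κ√κ ≤ 2(1 − d + ω)(Λ² − κ²)`.**  For a non-negative period-one DSS solution (`0 < κ < Λ`) born at rest with lifetime-integrable
feeds, drains and fluxes and a terminal profile `v`, on a LIT shell (`v_n > 0`) whose lag defect is at least `2Λv_n·d` and whose overshoot
excess is at most `ω·Λv_n²/(Λ² − κ√κ)`, the master identity yields this exact inequality between the contraction ratio and the two ratios.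
[cite: Tao2016AveragedNS, §1.2, §4 Lemma 4.1 (4.8)–(4.10), §6.4; elementary] -/
theorem gap_le_of_lag_margin (hε : 0 < ε₀) (hκ : 0 < κ) (hκΛ : κ < bigLam ε₀)
    (hV : ∀ (n : ℤ) (t : ℝ), t < 0 →
      HasDerivAt (V n) (bigLam ε₀ * V (n - 1) t ^ 2 - (bigLam ε₀)⁻¹ * (V n t * V (n + 1) t)) t)
    (hdss : ∀ (n : ℤ) (t : ℝ), t < 0 → V (n + 1) t = κ * V n (κ * t))
    (hP : ∀ k t, P k t = 2 * (((bigLam ε₀ ^ k)⁻¹) ^ 2 * (bigLam ε₀)⁻¹) * (V k t ^ 2 * V (k + 1) t))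
    (hv : ∀ n : ℤ, Tendsto (V n) (𝓝[<] 0) (𝓝 (v n)))
    (hpast : ∀ k : ℤ, Tendsto (V k) atBot (𝓝 0))
    (hsq : ∀ k : ℤ, IntegrableOn (fun t => V k t ^ 2) (Iic 0))
    (hdr : ∀ k : ℤ, IntegrableOn (fun t => V k t * V (k + 1) t) (Iic 0))
    (hPint : ∀ k : ℤ, IntegrableOn (P k) (Iic 0))
    {n : ℤ} (hvn : 0 < v n) {d ω : ℝ}
    (hLD : 2 * bigLam ε₀ * v n * d ≤
      ∫ t in Iio 0, (Real.sqrt κ * V n t ^ 2 - 2 * (V n t * V (n + 1) t) + (Real.sqrt κ)⁻¹ * V (n + 1) t ^ 2))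
    (hOE : -(∫ t in Iio 0, V (n - 1) t ^ 2 * (v n - V n t)) ≤ ω * (bigLam ε₀ * v n ^ 2 / (bigLam ε₀ ^ 2 - κ * Real.sqrt κ))) :
    bigLam ε₀ ^ 2 - κ * Real.sqrt κ ≤ 2 * (1 - d + ω) * (bigLam ε₀ ^ 2 - κ ^ 2) := by
  have hΛ : 0 < bigLam ε₀ := bigLam_pos (by linarith)
  have hκ2 : κ ^ 2 < bigLam ε₀ ^ 2 := pow_lt_pow_left₀ hκΛ hκ.le two_ne_zero
  have hsqrt : Real.sqrt κ < bigLam ε₀ := by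
    have hΛ1 : 1 < bigLam ε₀ := Real.one_lt_rpow (by linarith) (by norm_num)
    rw [Real.sqrt_lt' hΛ]; nlinarith
  have hgap : 0 < bigLam ε₀ ^ 2 - κ * Real.sqrt κ := by
    have : κ * Real.sqrt κ < bigLam ε₀ * bigLam ε₀ := mul_lt_mul'' hκΛ hsqrt hκ.le (Real.sqrt_nonneg κ)
    nlinarith
  have hden : 0 < 1 - κ ^ 2 / bigLam ε₀ ^ 2 := by
    rw [sub_pos, div_lt_one (pow_pos hΛ 2)]; exact hκ2
  have hM := DSSMasterIdentity.master_identity hε hκ hκΛ hV hdss hP hv hpast hsq hdr hPint n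
  set D := ∫ t in Iio 0, (Real.sqrt κ * V n t ^ 2 - 2 * (V n t * V (n + 1) t) + (Real.sqrt κ)⁻¹ * V (n + 1) t ^ 2)
    with hD
  set E := ∫ t in Iio 0, V (n - 1) t ^ 2 * (v n - V n t) with hE
  -- from the master identity: `v²/(2Λ(1−κ²/Λ²)) = Λ v (v − D/(2Λ))/G − E ≤ Λ v² (1 − d)/G + ω Λ v²/G`
  have h1 : bigLam ε₀ * v n * (v n - D / (2 * bigLam ε₀)) / (bigLam ε₀ ^ 2 - κ * Real.sqrt κ)
      ≤ bigLam ε₀ * v n ^ 2 * (1 - d) / (bigLam ε₀ ^ 2 - κ * Real.sqrt κ) := by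
    refine div_le_div_of_nonneg_right ?_ hgap.le
    have hDd : v n * d ≤ D / (2 * bigLam ε₀) := by
      rw [le_div_iff₀ (by positivity)]; linarith
    have : bigLam ε₀ * v n * (v n - D / (2 * bigLam ε₀)) = bigLam ε₀ * v n ^ 2 - bigLam ε₀ * v n * (D / (2 * bigLam ε₀)) := by
      ring
    rw [this]
    have : bigLam ε₀ * v n ^ 2 * (1 - d) = bigLam ε₀ * v n ^ 2 - bigLam ε₀ * v n * (v n * d) := by ring
    rw [this]
    have := mul_le_mul_of_nonneg_left hDd (mul_pos hΛ hvn).le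
    linarith
  have h2 : v n ^ 2 / (2 * bigLam ε₀ * (1 - κ ^ 2 / bigLam ε₀ ^ 2))
      ≤ bigLam ε₀ * v n ^ 2 * (1 - d + ω) / (bigLam ε₀ ^ 2 - κ * Real.sqrt κ) := by
    have e : v n ^ 2 / (2 * bigLam ε₀ * (1 - κ ^ 2 / bigLam ε₀ ^ 2))
        = bigLam ε₀ * v n * (v n - D / (2 * bigLam ε₀)) / (bigLam ε₀ ^ 2 - κ * Real.sqrt κ) - E := by
      rw [hM]; ring
    rw [e]
    have e2 : bigLam ε₀ * v n ^ 2 * (1 - d + ω) / (bigLam ε₀ ^ 2 - κ * Real.sqrt κ)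
        = bigLam ε₀ * v n ^ 2 * (1 - d) / (bigLam ε₀ ^ 2 - κ * Real.sqrt κ)
          + ω * (bigLam ε₀ * v n ^ 2 / (bigLam ε₀ ^ 2 - κ * Real.sqrt κ)) := by
      field_simp
    rw [e2]
    linarith
  -- divide by `v² > 0` and clear denominators
  have hv2 : 0 < v n ^ 2 := by positivity
  have h3 : 1 / (2 * bigLam ε₀ * (1 - κ ^ 2 / bigLam ε₀ ^ 2))
      ≤ bigLam ε₀ * (1 - d + ω) / (bigLam ε₀ ^ 2 - κ * Real.sqrt κ) := by
    have e1 : v n ^ 2 / (2 * bigLam ε₀ * (1 - κ ^ 2 / bigLam ε₀ ^ 2))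
        = v n ^ 2 * (1 / (2 * bigLam ε₀ * (1 - κ ^ 2 / bigLam ε₀ ^ 2))) := by ring
    have e2 : bigLam ε₀ * v n ^ 2 * (1 - d + ω) / (bigLam ε₀ ^ 2 - κ * Real.sqrt κ)
        = v n ^ 2 * (bigLam ε₀ * (1 - d + ω) / (bigLam ε₀ ^ 2 - κ * Real.sqrt κ)) := by ring
    rw [e1, e2] at h2
    exact le_of_mul_le_mul_left h2 hv2
  have h4 : 1 - κ ^ 2 / bigLam ε₀ ^ 2 = (bigLam ε₀ ^ 2 - κ ^ 2) / bigLam ε₀ ^ 2 := by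
    field_simp
  rw [h4] at h3
  rw [div_le_div_iff₀ (by positivity) hgap] at h3
  have h5 : 2 * bigLam ε₀ * ((bigLam ε₀ ^ 2 - κ ^ 2) / bigLam ε₀ ^ 2)
      = 2 * (bigLam ε₀ ^ 2 - κ ^ 2) / bigLam ε₀ := by
    field_simp
  rw [h5] at h3
  -- `h3 : 1 * (Λ² − κ√κ) ≤ Λ (1 − d + ω) · (2(Λ² − κ²)/Λ)`
  have h6 : bigLam ε₀ * (1 - d + ω) * (2 * (bigLam ε₀ ^ 2 - κ ^ 2) / bigLam ε₀)
      = 2 * (1 - d + ω) * (bigLam ε₀ ^ 2 - κ ^ 2) := by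
    field_simp
  rw [h6, one_mul] at h3
  exact h3

/-- **THE EXACT LAG-MARGIN CRITERION (scalar form).**  Under the hypotheses of `gap_le_of_lag_margin`, if moreover
`(1+ε₀)·(1 − 2(d − ω)) < 1` — i.e. the lag margin `d − ω` exceeds `ε₀/(2(1+ε₀))` — then `κ < (1+ε₀)²`: the front contracts faster than
the (S₁) threshold allows, so the wave is not (S₁)-surviving.  No smallness of `ε₀` is assumed.
[cite: Tao2016AveragedNS, §1.2, §4 Lemma 4.1 (4.8)–(4.10) and the viscous equation before Thm. 4.2, §6.4; elementary] -/
theorem kappa_lt_of_lag_margin (hε : 0 < ε₀) (hκ : 0 < κ) (hκΛ : κ < bigLam ε₀)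
    (hV : ∀ (n : ℤ) (t : ℝ), t < 0 →
      HasDerivAt (V n) (bigLam ε₀ * V (n - 1) t ^ 2 - (bigLam ε₀)⁻¹ * (V n t * V (n + 1) t)) t)
    (hdss : ∀ (n : ℤ) (t : ℝ), t < 0 → V (n + 1) t = κ * V n (κ * t))
    (hP : ∀ k t, P k t = 2 * (((bigLam ε₀ ^ k)⁻¹) ^ 2 * (bigLam ε₀)⁻¹) * (V k t ^ 2 * V (k + 1) t))
    (hv : ∀ n : ℤ, Tendsto (V n) (𝓝[<] 0) (𝓝 (v n)))
    (hpast : ∀ k : ℤ, Tendsto (V k) atBot (𝓝 0))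
    (hsq : ∀ k : ℤ, IntegrableOn (fun t => V k t ^ 2) (Iic 0))
    (hdr : ∀ k : ℤ, IntegrableOn (fun t => V k t * V (k + 1) t) (Iic 0))
    (hPint : ∀ k : ℤ, IntegrableOn (P k) (Iic 0))
    {n : ℤ} (hvn : 0 < v n) {d ω : ℝ}
    (hLD : 2 * bigLam ε₀ * v n * d ≤
      ∫ t in Iio 0, (Real.sqrt κ * V n t ^ 2 - 2 * (V n t * V (n + 1) t) + (Real.sqrt κ)⁻¹ * V (n + 1) t ^ 2))
    (hOE : -(∫ t in Iio 0, V (n - 1) t ^ 2 * (v n - V n t)) ≤ ω * (bigLam ε₀ * v n ^ 2 / (bigLam ε₀ ^ 2 - κ * Real.sqrt κ)))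
    (hmargin : (1 + ε₀) * (1 - 2 * (d - ω)) < 1) :
    κ < (1 + ε₀) ^ 2 := by
  have hgap := gap_le_of_lag_margin hε hκ hκΛ hV hdss hP hv hpast hsq hdr hPint hvn hLD hOE
  by_contra hge
  have hge : (1 + ε₀) ^ 2 ≤ κ := not_lt.1 hge
  -- `b = 1+ε₀`, `s = √κ`
  have hb : 1 < 1 + ε₀ := by linarith
  have hb0 : 0 < 1 + ε₀ := by linarith
  set s := Real.sqrt κ with hs
  have hs0 : 0 ≤ s := Real.sqrt_nonneg κ
  have hss : s ^ 2 = κ := Real.sq_sqrt hκ.le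
  have hs3 : κ * s = s ^ 3 := by
    calc κ * s = s ^ 2 * s := by rw [hss]
      _ = s ^ 3 := by ring
  have hs4 : κ ^ 2 = s ^ 4 := by rw [← hss]; ring
  have hΛ2 : bigLam ε₀ ^ 2 = (1 + ε₀) ^ 5 := bigLam_sq hε.le
  -- `b ≤ s` from `b² ≤ κ = s²`
  have hbs : 1 + ε₀ ≤ s := by
    have : (1 + ε₀) ^ 2 ≤ s ^ 2 := by rw [hss]; exact hge
    exact (pow_le_pow_iff_left₀ hb0.le hs0 two_ne_zero).1 this
  -- `s⁴ < b⁵` from `κ < Λ`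
  have hs4lt : s ^ 4 < (1 + ε₀) ^ 5 := by
    rw [← hs4, ← hΛ2]
    exact pow_lt_pow_left₀ hκΛ hκ.le two_ne_zero
  have hq : (2 * (1 - d + ω) - 1) * (1 + ε₀) < 1 := by nlinarith
  have halg := no_survivor_algebra hb hbs hs4lt hq
  rw [hΛ2, hs3, hs4] at hgap
  linarith

/-! ## §3 By name: admissible single-profile DSS waves of the dyadic member -/

/-- The (S₁) window in the contraction ratio: `Surviving 1 ε₀ T` gives `(1+ε₀)² ≤ e^{T}` (from `(1+ε₀)⁻¹ ≤ dssMu ε₀ T = e^{2T}/(1+ε₀)⁵`).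
[cite: Tao2016AveragedNS, §4 (the viscous equation before Thm. 4.2), §6.4; cell vocabulary `Surviving`, `dssMu`] -/
theorem sq_le_exp_of_surviving {T : ℝ} (hε : 0 < ε₀) (hS : Surviving 1 ε₀ T) : (1 + ε₀) ^ 2 ≤ Real.exp T := by
  obtain ⟨hlo, -⟩ := hS
  have h1 : 0 < 1 + ε₀ := by linarith
  have h5 : 0 < (1 + ε₀) ^ 5 := pow_pos h1 5
  have h4 : (1 + ε₀) ^ 4 ≤ Real.exp (2 * T) := by
    unfold dssMu at hlo
    rw [le_div_iff₀ h5] at hlo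
    have e : (1 + ε₀) ^ (-(1 : ℝ)) * (1 + ε₀) ^ 5 = (1 + ε₀) ^ 4 := by
      rw [Real.rpow_neg h1.le, Real.rpow_one]
      field_simp
    rw [e] at hlo
    exact hlo
  have hsq : ((1 + ε₀) ^ 2) ^ 2 ≤ Real.exp T ^ 2 := by
    rw [← pow_mul, ← Real.exp_nat_mul]
    push_cast
    simpa using h4
  exact (pow_le_pow_iff_left₀ (pow_nonneg h1.le 2) (Real.exp_pos T).le two_ne_zero).1 hsq

section DSS

variable {perm : Equiv.Perm (Fin 1)} {T : ℝ} {Φ : Fin 1 → ℝ → Em 4} {r₀ : Fin 1}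

/-- **THE EXACT LAG-MARGIN CRITERION, BY NAME.**  Let `Φ` carry an admissible single-profile DSS wave of `dyadicTable` with delay `T`,
sub-unitary (`dssMu ε₀ T < 1`), and let `r` be the terminal profile of its eternal solution `W = dssEmbed π T Φ r₀`.  Write
`V_k(t) = (−t)⁻¹(W_k(−log(−t)))₀` (critical variables, contraction ratio `κ = e^{T}`), `v_k = (r_k)₀`.  If on ONE lit shell `n`
(`v_n > 0`) the lag defect and the lag energy obey `D_n ≥ 2Λv_n·d` and `−E_n ≤ ω·Λv_n²/(Λ² − κ√κ)` with
`(1+ε₀)(1 − 2(d − ω)) < 1`, then the wave is NOT (S₁)-surviving.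
[cite: Tao2016AveragedNS, §1.2, §4 Lemma 4.1 (4.8)–(4.10) and the viscous equation before Thm. 4.2, §6.4; elementary] -/
theorem dssWave_not_surviving_of_lag_margin (hε : 0 < ε₀) (hΦ : IsDSSWave ε₀ dyadicTable perm T Φ) (hμ : dssMu ε₀ T < 1)
    {r : ℤ → Em 4} (hr : ∀ k : ℤ, Tendsto (fun σ : ℝ => Real.exp σ • dssEmbed perm T Φ r₀ k σ) atTop (𝓝 (r k)))
    {n : ℤ} (hn : 0 < r n 0) {d ω : ℝ}
    (hLD : 2 * bigLam ε₀ * r n 0 * d ≤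
      ∫ t in Iio 0, (Real.sqrt (Real.exp T) * ((-t)⁻¹ * (dssEmbed perm T Φ r₀ n (-Real.log (-t))) 0) ^ 2
        - 2 * (((-t)⁻¹ * (dssEmbed perm T Φ r₀ n (-Real.log (-t))) 0)
            * ((-t)⁻¹ * (dssEmbed perm T Φ r₀ (n + 1) (-Real.log (-t))) 0))
        + (Real.sqrt (Real.exp T))⁻¹ * ((-t)⁻¹ * (dssEmbed perm T Φ r₀ (n + 1) (-Real.log (-t))) 0) ^ 2))
    (hOE : -(∫ t in Iio 0, ((-t)⁻¹ * (dssEmbed perm T Φ r₀ (n - 1) (-Real.log (-t))) 0) ^ 2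
        * (r n 0 - (-t)⁻¹ * (dssEmbed perm T Φ r₀ n (-Real.log (-t))) 0))
      ≤ ω * (bigLam ε₀ * (r n 0) ^ 2 / (bigLam ε₀ ^ 2 - Real.exp T * Real.sqrt (Real.exp T))))
    (hmargin : (1 + ε₀) * (1 - 2 * (d - ω)) < 1) :
    ¬ Surviving 1 ε₀ T := by
  intro hS
  have hW : IsEternal ε₀ dyadicTable (dssEmbed perm T Φ r₀) := hΦ.isEternal_dssEmbed r₀
  have hlt : Real.exp T < (1 + ε₀) ^ 2 :=
    kappa_lt_of_lag_margin
      (V := fun (k : ℤ) (s : ℝ) => (-s)⁻¹ * (dssEmbed perm T Φ r₀ k (-Real.log (-s))) 0)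
      (v := fun k => r k 0)
      (P := fun (k : ℤ) (s : ℝ) => 2 * (((bigLam ε₀ ^ k)⁻¹) ^ 2 * (bigLam ε₀)⁻¹) *
        (((-s)⁻¹ * (dssEmbed perm T Φ r₀ k (-Real.log (-s))) 0) ^ 2 *
          ((-s)⁻¹ * (dssEmbed perm T Φ r₀ (k + 1) (-Real.log (-s))) 0)))
      hε (Real.exp_pos T) (DSSFrontOvershoot.exp_lt_bigLam_of_dssMu_lt_one hε hμ)
      (fun k t ht => dyadic_crit_hasDerivAt hW k ht) (fun k t ht => DSSFrontOvershoot.crit_dss T Φ perm r₀ k ht)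
      (fun k t => rfl) (fun k => dyadic_crit_tendsto hr k) (fun k => DSSFrontOvershoot.crit_tendsto_atBot hε hW k)
      (fun k => DSSFrontOvershoot.crit_integrableOn_sq hε hW k) (fun k => DSSFrontOvershoot.crit_integrableOn_mul hε hW k)
      (fun k => DSSFrontOvershoot.crit_integrableOn_flux hε hW k) (n := n) hn hLD hOE hmargin
  exact absurd (sq_le_exp_of_surviving hε hS) (not_le.2 hlt)

end DSS

/-! ## §4 The lag margin is the survival discriminant — exactly

By (I1′)/(I2) the two ratios are not independent: their difference is a function of `κ` alone, so the (LD)+(OE) programme is ONE unknown —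
a proof must supply an inequality on `D_n` or `E_n` that is not a consequence of the identities (front sharpness / an overshoot bound). -/

/-- **EXACT LAG MARGIN.**  Under the hypotheses of the master identity, on a lit shell (`v_n > 0`) the exact ratios `d⋆ = D_n/(2Λv_n)` and
`ω⋆ = −E_n·(Λ² − κ√κ)/(Λv_n²)` satisfy `d⋆ − ω⋆ = 1 − (Λ² − κ√κ)/(2(Λ² − κ²))` — a function of `κ` (and `Λ`) only.
[cite: Tao2016AveragedNS, §1.2, §4 Lemma 4.1 (4.8)–(4.10), §6.4; elementary] -/
theorem lagMargin_eq (hε : 0 < ε₀) (hκ : 0 < κ) (hκΛ : κ < bigLam ε₀)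
    (hV : ∀ (n : ℤ) (t : ℝ), t < 0 →
      HasDerivAt (V n) (bigLam ε₀ * V (n - 1) t ^ 2 - (bigLam ε₀)⁻¹ * (V n t * V (n + 1) t)) t)
    (hdss : ∀ (n : ℤ) (t : ℝ), t < 0 → V (n + 1) t = κ * V n (κ * t))
    (hP : ∀ k t, P k t = 2 * (((bigLam ε₀ ^ k)⁻¹) ^ 2 * (bigLam ε₀)⁻¹) * (V k t ^ 2 * V (k + 1) t))
    (hv : ∀ n : ℤ, Tendsto (V n) (𝓝[<] 0) (𝓝 (v n)))
    (hpast : ∀ k : ℤ, Tendsto (V k) atBot (𝓝 0))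
    (hsq : ∀ k : ℤ, IntegrableOn (fun t => V k t ^ 2) (Iic 0))
    (hdr : ∀ k : ℤ, IntegrableOn (fun t => V k t * V (k + 1) t) (Iic 0))
    (hPint : ∀ k : ℤ, IntegrableOn (P k) (Iic 0))
    {n : ℤ} (hvn : 0 < v n) :
    (∫ t in Iio 0, (Real.sqrt κ * V n t ^ 2 - 2 * (V n t * V (n + 1) t) + (Real.sqrt κ)⁻¹ * V (n + 1) t ^ 2))
        / (2 * bigLam ε₀ * v n)
      - (-(∫ t in Iio 0, V (n - 1) t ^ 2 * (v n - V n t))) * (bigLam ε₀ ^ 2 - κ * Real.sqrt κ)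
        / (bigLam ε₀ * v n ^ 2)
      = 1 - (bigLam ε₀ ^ 2 - κ * Real.sqrt κ) / (2 * (bigLam ε₀ ^ 2 - κ ^ 2)) := by
  have hΛ : 0 < bigLam ε₀ := bigLam_pos (by linarith)
  have hκ2 : κ ^ 2 < bigLam ε₀ ^ 2 := pow_lt_pow_left₀ hκΛ hκ.le two_ne_zero
  have hsqrt : Real.sqrt κ < bigLam ε₀ := by
    have hΛ1 : 1 < bigLam ε₀ := Real.one_lt_rpow (by linarith) (by norm_num)
    rw [Real.sqrt_lt' hΛ]; nlinarith
  have hgap : 0 < bigLam ε₀ ^ 2 - κ * Real.sqrt κ := by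
    have : κ * Real.sqrt κ < bigLam ε₀ * bigLam ε₀ := mul_lt_mul'' hκΛ hsqrt hκ.le (Real.sqrt_nonneg κ)
    nlinarith
  have hH : 0 < bigLam ε₀ ^ 2 - κ ^ 2 := by linarith
  have hden : 1 - κ ^ 2 / bigLam ε₀ ^ 2 = (bigLam ε₀ ^ 2 - κ ^ 2) / bigLam ε₀ ^ 2 := by
    field_simp
  have hM := DSSMasterIdentity.master_identity hε hκ hκΛ hV hdss hP hv hpast hsq hdr hPint n
  rw [hden] at hM
  set D := ∫ t in Iio 0, (Real.sqrt κ * V n t ^ 2 - 2 * (V n t * V (n + 1) t) + (Real.sqrt κ)⁻¹ * V (n + 1) t ^ 2)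
    with hD
  set E := ∫ t in Iio 0, V (n - 1) t ^ 2 * (v n - V n t) with hE
  set G := bigLam ε₀ ^ 2 - κ * Real.sqrt κ with hG
  rw [hM]
  have hΛne : bigLam ε₀ ≠ 0 := hΛ.ne'
  have hvne : v n ≠ 0 := hvn.ne'
  have hGne : G ≠ 0 := hgap.ne'
  have hHne : bigLam ε₀ ^ 2 - κ ^ 2 ≠ 0 := hH.ne'
  field_simp
  ring

/-- **THE MARGIN CRITERION IS EXACTLY THE (S₁) THRESHOLD.**  For `0 < κ < Λ = (1+ε₀)^{5/2}` and the exact margin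
`m(κ) = 1 − (Λ² − κ√κ)/(2(Λ² − κ²))`: `(1+ε₀)·(1 − 2m(κ)) < 1 ↔ κ < (1+ε₀)²` (`b = 1+ε₀`, `s = √κ`:
`b⁵ − s⁴ − b(s⁴ − s³) = b(b⁴ − s⁴) + s³(b − s)`); so `kappa_lt_of_lag_margin` is sharp.
[cite: Tao2016AveragedNS, §4 (the viscous equation before Thm. 4.2), §6.4; elementary] -/
theorem margin_criterion_iff (hε : 0 < ε₀) (hκ : 0 < κ) (hκΛ : κ < bigLam ε₀) :
    (1 + ε₀) * (1 - 2 * (1 - (bigLam ε₀ ^ 2 - κ * Real.sqrt κ) / (2 * (bigLam ε₀ ^ 2 - κ ^ 2)))) < 1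
      ↔ κ < (1 + ε₀) ^ 2 := by
  have hb0 : 0 < 1 + ε₀ := by linarith
  have hκ2 : κ ^ 2 < bigLam ε₀ ^ 2 := pow_lt_pow_left₀ hκΛ hκ.le two_ne_zero
  have hH : 0 < bigLam ε₀ ^ 2 - κ ^ 2 := by linarith
  have hΛ2 : bigLam ε₀ ^ 2 = (1 + ε₀) ^ 5 := bigLam_sq hε.le
  set s := Real.sqrt κ with hs
  have hs0 : 0 < s := Real.sqrt_pos.2 hκ
  have hss : s ^ 2 = κ := Real.sq_sqrt hκ.le
  have hs3 : κ * s = s ^ 3 := by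
    calc κ * s = s ^ 2 * s := by rw [hss]
      _ = s ^ 3 := by ring
  have hs4 : κ ^ 2 = s ^ 4 := by rw [← hss]; ring
  -- rewrite the criterion as `(1+ε₀)(κ² − κ√κ) < Λ² − κ²`
  have hrew : (1 + ε₀) * (1 - 2 * (1 - (bigLam ε₀ ^ 2 - κ * s) / (2 * (bigLam ε₀ ^ 2 - κ ^ 2)))) < 1
      ↔ (1 + ε₀) * (κ ^ 2 - κ * s) < bigLam ε₀ ^ 2 - κ ^ 2 := by
    have e : 1 - 2 * (1 - (bigLam ε₀ ^ 2 - κ * s) / (2 * (bigLam ε₀ ^ 2 - κ ^ 2)))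
        = ((κ ^ 2 - κ * s) / (bigLam ε₀ ^ 2 - κ ^ 2)) := by
      field_simp
      ring
    rw [e, ← mul_div_assoc, div_lt_one hH]
  rw [hrew, hΛ2, hs3, hs4]
  -- `b(s⁴ − s³) < b⁵ − s⁴ ↔ 0 < b(b⁴ − s⁴) + s³(b − s) ↔ s < b ↔ s² < b²`
  have key : (1 + ε₀) ^ 5 - s ^ 4 - (1 + ε₀) * (s ^ 4 - s ^ 3)
      = (1 + ε₀) * ((1 + ε₀) ^ 4 - s ^ 4) + s ^ 3 * ((1 + ε₀) - s) := by ring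
  constructor
  · intro h
    -- if `b ≤ s` both summands are `≤ 0`
    by_contra hge
    have hge : (1 + ε₀) ^ 2 ≤ κ := not_lt.1 hge
    have hbs : 1 + ε₀ ≤ s := by
      have : (1 + ε₀) ^ 2 ≤ s ^ 2 := by rw [hss]; exact hge
      exact (pow_le_pow_iff_left₀ hb0.le hs0.le two_ne_zero).1 this
    have h1 : (1 + ε₀) ^ 4 - s ^ 4 ≤ 0 := by
      have := pow_le_pow_left₀ hb0.le hbs 4; linarith
    have h2 : s ^ 3 * ((1 + ε₀) - s) ≤ 0 :=
      mul_nonpos_of_nonneg_of_nonpos (pow_nonneg hs0.le 3) (by linarith)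
    have h3 : (1 + ε₀) * ((1 + ε₀) ^ 4 - s ^ 4) ≤ 0 := mul_nonpos_of_nonneg_of_nonpos hb0.le h1
    nlinarith [key]
  · intro h
    have hsb : s < 1 + ε₀ := by
      have : s ^ 2 < (1 + ε₀) ^ 2 := by rw [hss]; exact h
      exact (pow_lt_pow_iff_left₀ hs0.le hb0.le two_ne_zero).1 this
    have h1 : 0 < (1 + ε₀) ^ 4 - s ^ 4 := by
      have := pow_lt_pow_left₀ hsb hs0.le (by norm_num : (4 : ℕ) ≠ 0); linarith
    have h2 : 0 < s ^ 3 * ((1 + ε₀) - s) := mul_pos (pow_pos hs0 3) (by linarith)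
    have h3 : 0 < (1 + ε₀) * ((1 + ε₀) ^ 4 - s ^ 4) := mul_pos hb0 h1
    nlinarith [key]

end Summit.NavierStokesRegularity.NavierStokesRegularity.Theorems.NoSurvivingEternalViscBddOne.DSSLagMargin
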